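import Summits.PneNP.PneNP.Theses.PhaseTwins

/-!
# Route PhaseTwins, crux `PseudorandomTwinsAbove` (stmt-PneNP-2721) — negative side: the crux is FALSE against computationally unbounded (still index-free) tests

Negative lemmas for crux stmt-PneNP-2721 (`Summit.PneNP.PneNP.Theses.PhaseTwins.PseudorandomTwinsAbove`),
from the disprover's work file `Summits/PneNP/PneNP/Cruxes/PseudorandomTwinsAbove/Disproof.lean`.
* `pseudorandomTwinsAbove_false_without_polyTime` refutes the crux verbatim with the hypothesis
  `A.IsPolyTime id encodeBool` of clause (i) dropped (tests = all `RandAlg (List Bool) Bool`, still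
  INDEX-FREE: they never see `n`; `PseudorandomTwinsAboveWithoutPolyTime` in the work file) — any
  proof of the crux must use the time bound on the distinguishers, and the index-free typing of (i)
  (flagged in route review) is not an information-theoretic loophole.
* Mechanism, `no_setwise_indistinguishable_far_pair`: if `P n (U n) → 1`, `Q n (V n) → 1`,
  `U n ∩ V n = ∅` (clause (ii)), then not every FIXED set `S` has `|P n (S) − Q n (S)| → 0`:
  assuming it, finite sets have vanishing mass (`mass_finset_le_of_disjoint`) and a gliding-hump
  recursion yields one `S` with discrepancy `≥ 3/8` along a subsequence (Schur property of `ℓ¹`);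
  indicator tests `1_S` (`RandAlg.ofDet`) realise sets as tests (`tsum_indicatorTest_eq_mass`).
* `tv_lower_bound`, `not_indistinguishable_on_separating_events`: statistically close twins are
  impossible for every pair of ensembles. Companion file: `Negative/TestClassKernels.lean`.

References: J. Diestel, *Sequences and Series in Banach Spaces*, GTM 92 (1984), Ch. VII (Schur's
theorem, gliding hump); O. Goldreich, *Foundations of Cryptography I* (2001), §3.2, §3.8 Ex. 11.
[folklore]
-/

namespace Summit.PneNP.PneNP.Theorems.PseudorandomTwinsAbove.Negative

open Literature.Computability.Complexity Literature.Computability.MetaComplexity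
open Filter Topology
open scoped ENNReal

noncomputable section

/-! ## Real-valued masses of sets under a `PMF` -/

variable {X : Type*}

-- Masses of sets are written `(PMF.toOuterMeasure p S).toReal` throughout (the crux's
-- `Ensemble.prob D n S` unfolds to exactly this); no auxiliary definition is introduced.

/-- `p(S) + p(Sᶜ) = 1` in `ℝ≥0∞`. [folklore] -/
theorem toOuterMeasure_add_compl' (p : PMF X) (s : Set X) :
    p.toOuterMeasure s + p.toOuterMeasure sᶜ = 1 := by
  rw [PMF.toOuterMeasure_apply, PMF.toOuterMeasure_apply, ← ENNReal.tsum_add, ← p.tsum_coe]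
  refine tsum_congr fun x => ?_
  by_cases hx : x ∈ s
  · rw [Set.indicator_of_mem hx, Set.indicator_of_notMem (show x ∉ sᶜ from fun h => h hx),
      add_zero]
  · rw [Set.indicator_of_notMem hx, Set.indicator_of_mem (show x ∈ sᶜ from hx), zero_add]

/-- `p(S) ≤ 1`. [folklore] -/
theorem toOuterMeasure_le_one' (p : PMF X) (s : Set X) : p.toOuterMeasure s ≤ 1 :=
  le_of_le_of_eq le_self_add (toOuterMeasure_add_compl' p s)
/-- `p(S) ≠ ∞`. [folklore] -/
theorem toOuterMeasure_ne_top' (p : PMF X) (s : Set X) : p.toOuterMeasure s ≠ ∞ :=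
  ((toOuterMeasure_le_one' p s).trans_lt ENNReal.one_lt_top).ne
/-- `(PMF.toOuterMeasure p S).toReal ≤ 1`. [folklore] -/
theorem mass_le_one (p : PMF X) (S : Set X) : (PMF.toOuterMeasure p S).toReal ≤ 1 := by
  have h := ENNReal.toReal_mono ENNReal.one_ne_top (toOuterMeasure_le_one' p S)
  simpa using h

/-- Monotonicity. [folklore] -/
theorem mass_mono (p : PMF X) {S T : Set X} (h : S ⊆ T) : (PMF.toOuterMeasure p S).toReal ≤ (PMF.toOuterMeasure p T).toReal :=
  ENNReal.toReal_mono (toOuterMeasure_ne_top' p T) (p.toOuterMeasure.mono h)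

/-- Binary subadditivity. [folklore] -/
theorem mass_union_le (p : PMF X) (S T : Set X) : (PMF.toOuterMeasure p (S ∪ T)).toReal ≤ (PMF.toOuterMeasure p S).toReal + (PMF.toOuterMeasure p T).toReal := by
  rw [← ENNReal.toReal_add (toOuterMeasure_ne_top' p S) (toOuterMeasure_ne_top' p T)]
  exact ENNReal.toReal_mono
    (ENNReal.add_ne_top.2 ⟨toOuterMeasure_ne_top' p S, toOuterMeasure_ne_top' p T⟩)
    (MeasureTheory.measure_union_le S T)

/-- Complements. [folklore] -/
theorem mass_add_compl (p : PMF X) (S : Set X) : (PMF.toOuterMeasure p S).toReal + (PMF.toOuterMeasure p Sᶜ).toReal = 1 := by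
  rw [← ENNReal.toReal_add (toOuterMeasure_ne_top' p S) (toOuterMeasure_ne_top' p Sᶜ),
    toOuterMeasure_add_compl', ENNReal.toReal_one]

/-- Mass of a finite set. [folklore] -/
theorem mass_finset (p : PMF X) (E : Finset X) : (PMF.toOuterMeasure p (↑E)).toReal = ∑ x ∈ E, (p x).toReal := by
  rw [PMF.toOuterMeasure_apply_finset, ENNReal.toReal_sum (fun x _ => PMF.apply_ne_top p x)]

/-- Mass of a singleton. [folklore] -/
theorem mass_singleton (p : PMF X) (x : X) : (PMF.toOuterMeasure p {x}).toReal = (p x).toReal := by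
  rw [PMF.toOuterMeasure_apply_singleton]

/-- Tightness of a single `PMF`: a finite set carries all but `δ` of the mass. [folklore] -/
theorem exists_finset_mass_compl_le (p : PMF X) {δ : ℝ} (hδ : 0 < δ) :
    ∃ E : Finset X, (PMF.toOuterMeasure p ((↑E)ᶜ)).toReal ≤ δ := by
  have hsum : ∑' x, p x ≠ ∞ := by rw [p.tsum_coe]; exact ENNReal.one_ne_top
  have h := ENNReal.tendsto_tsum_compl_atTop_zero hsum
  have hδ' : (0 : ℝ≥0∞) < ENNReal.ofReal δ := by simpa using hδ
  obtain ⟨E, hE⟩ := (h.eventually (ge_mem_nhds hδ')).exists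
  refine ⟨E, ?_⟩
  have hcompl : p.toOuterMeasure (↑E)ᶜ = ∑' b : {x // x ∉ E}, p b := by
    rw [PMF.toOuterMeasure_apply, ← tsum_subtype]
    rfl
  rw [hcompl]
  exact (ENNReal.toReal_mono ENNReal.ofReal_ne_top hE).trans_eq (ENNReal.toReal_ofReal hδ.le)

/-- KEY ESTIMATE. If `U ∩ V = ∅`, a finite set `Φ` has `p`-mass at most
`Σ_{x∈Φ} |p(x) − q(x)| + (1 − q(V)) + (1 − p(U))`: split `Φ` along `U`; the part inside `U` is
compared pointwise with `q`, which gives `U ⊆ Vᶜ` little mass; the part outside `U` has little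
`p`-mass. [folklore] -/
theorem mass_finset_le_of_disjoint (p q : PMF X) {U V : Set X} (hUV : Disjoint U V)
    (Φ : Finset X) :
    (PMF.toOuterMeasure p (↑Φ)).toReal ≤ (∑ x ∈ Φ, |(PMF.toOuterMeasure p {x}).toReal - (PMF.toOuterMeasure q {x}).toReal|) + (1 - (PMF.toOuterMeasure q V).toReal) + (1 - (PMF.toOuterMeasure p U).toReal) := by
  classical
  simp only [mass_singleton]
  set Φ₁ := Φ.filter (fun x => x ∈ U) with hΦ₁
  set Φ₂ := Φ.filter (fun x => x ∉ U) with hΦ₂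
  have hsplit : (↑Φ : Set X) ⊆ ↑Φ₁ ∪ ↑Φ₂ := by
    intro x hx
    have hx' : x ∈ Φ := Finset.mem_coe.1 hx
    by_cases hU : x ∈ U
    · exact Or.inl (Finset.mem_coe.2 (Finset.mem_filter.2 ⟨hx', hU⟩))
    · exact Or.inr (Finset.mem_coe.2 (Finset.mem_filter.2 ⟨hx', hU⟩))
  have h1 : (PMF.toOuterMeasure p (↑Φ₁)).toReal ≤ (∑ x ∈ Φ, |(p x).toReal - (q x).toReal|) + (1 - (PMF.toOuterMeasure q V).toReal) := by
    have hq : (PMF.toOuterMeasure q (↑Φ₁)).toReal ≤ 1 - (PMF.toOuterMeasure q V).toReal := by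
      have hsub : (↑Φ₁ : Set X) ⊆ Vᶜ := by
        intro x hx hxV
        have hxU : x ∈ U := (Finset.mem_filter.1 (Finset.mem_coe.1 hx)).2
        exact Set.disjoint_left.1 hUV hxU hxV
      have h' := mass_mono q hsub
      have hc := mass_add_compl q V
      linarith
    rw [mass_finset] at hq ⊢
    calc ∑ x ∈ Φ₁, (p x).toReal
        ≤ ∑ x ∈ Φ₁, ((q x).toReal + |(p x).toReal - (q x).toReal|) := by
          refine Finset.sum_le_sum fun x _ => ?_
          have := le_abs_self ((p x).toReal - (q x).toReal)
          linarith
      _ = ∑ x ∈ Φ₁, (q x).toReal + ∑ x ∈ Φ₁, |(p x).toReal - (q x).toReal| :=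
          Finset.sum_add_distrib
      _ ≤ (1 - (PMF.toOuterMeasure q V).toReal) + ∑ x ∈ Φ, |(p x).toReal - (q x).toReal| := by
          have hle : ∑ x ∈ Φ₁, |(p x).toReal - (q x).toReal|
              ≤ ∑ x ∈ Φ, |(p x).toReal - (q x).toReal| :=
            Finset.sum_le_sum_of_subset_of_nonneg (Finset.filter_subset _ _)
              (fun _ _ _ => abs_nonneg _)
          linarith
      _ = _ := by ring
  have h2 : (PMF.toOuterMeasure p (↑Φ₂)).toReal ≤ 1 - (PMF.toOuterMeasure p U).toReal := by
    have hsub : (↑Φ₂ : Set X) ⊆ Uᶜ := by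
      intro x hx
      exact (Finset.mem_filter.1 (Finset.mem_coe.1 hx)).2
    have h' := mass_mono p hsub
    have hc := mass_add_compl p U
    linarith
  calc (PMF.toOuterMeasure p (↑Φ)).toReal ≤ (PMF.toOuterMeasure p (↑Φ₁ ∪ ↑Φ₂)).toReal := mass_mono p hsplit
    _ ≤ (PMF.toOuterMeasure p (↑Φ₁)).toReal + (PMF.toOuterMeasure p (↑Φ₂)).toReal := mass_union_le p _ _
    _ ≤ _ := by linarith

/-! ## The gliding hump: no pair of ensembles is setwise indistinguishable and far apart -/

/-- MAIN NEGATIVE LEMMA (abstract form). Let `P n`, `Q n` be probability mass functions and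
`U n ∩ V n = ∅` with `P n (U n) → 1`, `Q n (V n) → 1` (this is clause (ii) of the crux). Then
it is impossible that EVERY fixed set `S` (an index-free, computationally unbounded test) has
`|P n (S) − Q n (S)| → 0`. Proof: assuming it, every finite set has vanishing `P n`- and
`Q n`-mass (key estimate), and a gliding-hump recursion `n₁ < n₂ < ⋯` with finite humps
`F_k ⊆ U (n_k)` builds one set `S = ⋃ F_k` with `P (n_k) S ≥ 11/16`, `Q (n_k) S ≤ 5/16`
for all `k`. (This is the Schur property of `ℓ¹` specialised to differences of probability
vectors with asymptotically disjoint supports.) [folklore] -/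
theorem no_setwise_indistinguishable_far_pair (P Q : ℕ → PMF X) (U V : ℕ → Set X)
    (hUV : ∀ n, Disjoint (U n) (V n))
    (hP : Tendsto (fun n => (PMF.toOuterMeasure (P n) (U n)).toReal) atTop (𝓝 1))
    (hQ : Tendsto (fun n => (PMF.toOuterMeasure (Q n) (V n)).toReal) atTop (𝓝 1))
    (h : ∀ S : Set X, Tendsto (fun n => |(PMF.toOuterMeasure (P n) S).toReal - (PMF.toOuterMeasure (Q n) S).toReal|) atTop (𝓝 0)) :
    False := by
  classical
  -- pointwise discrepancy on a finite set
  set d : ℕ → Finset X → ℝ := fun n Φ => ∑ x ∈ Φ, |(PMF.toOuterMeasure (P n) {x}).toReal - (PMF.toOuterMeasure (Q n) {x}).toReal| with hd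
  have hd_tendsto : ∀ Φ : Finset X, Tendsto (fun n => d n Φ) atTop (𝓝 0) := by
    intro Φ
    have h' := tendsto_finsetSum Φ (fun x (_ : x ∈ Φ) => h {x})
    simpa [hd] using h'
  -- good indices exist beyond any bound
  have hstep : ∀ (m : ℕ) (Φ : Finset X), ∃ n, m < n ∧ d n Φ ≤ 1 / 16 ∧
      15 / 16 ≤ (PMF.toOuterMeasure (P n) (U n)).toReal ∧ 15 / 16 ≤ (PMF.toOuterMeasure (Q n) (V n)).toReal := by
    intro m Φ
    have e1 := (hd_tendsto Φ).eventually_lt_const (show (0 : ℝ) < 1 / 16 by norm_num)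
    have e2 := hP.eventually_const_lt (show (15 / 16 : ℝ) < 1 by norm_num)
    have e3 := hQ.eventually_const_lt (show (15 / 16 : ℝ) < 1 by norm_num)
    obtain ⟨n, hn⟩ := ((eventually_gt_atTop m).and (e1.and (e2.and e3))).exists
    exact ⟨n, hn.1, hn.2.1.le, hn.2.2.1.le, hn.2.2.2.le⟩
  -- two-sided tightness at every index
  have htight : ∀ n, ∃ E : Finset X, (PMF.toOuterMeasure (P n) ((↑E)ᶜ)).toReal ≤ 1 / 16 ∧ (PMF.toOuterMeasure (Q n) ((↑E)ᶜ)).toReal ≤ 1 / 16 := by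
    intro n
    obtain ⟨E₁, h₁⟩ := exists_finset_mass_compl_le (P n) (show (0 : ℝ) < 1 / 16 by norm_num)
    obtain ⟨E₂, h₂⟩ := exists_finset_mass_compl_le (Q n) (show (0 : ℝ) < 1 / 16 by norm_num)
    refine ⟨E₁ ∪ E₂, ?_, ?_⟩
    · refine (mass_mono _ (Set.compl_subset_compl.2 ?_)).trans h₁
      rw [Finset.coe_union]; exact Set.subset_union_left
    · refine (mass_mono _ (Set.compl_subset_compl.2 ?_)).trans h₂
      rw [Finset.coe_union]; exact Set.subset_union_right
  -- the recursion: state = (last index, union of all finite sets used so far)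
  let nOf : ℕ × Finset X → ℕ := fun s => Classical.choose (hstep s.1 s.2)
  have nOf_spec : ∀ s : ℕ × Finset X, s.1 < nOf s ∧ d (nOf s) s.2 ≤ 1 / 16 ∧
      15 / 16 ≤ (PMF.toOuterMeasure (P (nOf s)) ((U (nOf s)))).toReal ∧ 15 / 16 ≤ (PMF.toOuterMeasure (Q (nOf s)) ((V (nOf s)))).toReal :=
    fun s => Classical.choose_spec (hstep s.1 s.2)
  let EOf : ℕ × Finset X → Finset X := fun s => Classical.choose (htight (nOf s))
  have EOf_spec : ∀ s : ℕ × Finset X,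
      (PMF.toOuterMeasure (P (nOf s)) ((↑(EOf s))ᶜ)).toReal ≤ 1 / 16 ∧ (PMF.toOuterMeasure (Q (nOf s)) ((↑(EOf s))ᶜ)).toReal ≤ 1 / 16 :=
    fun s => Classical.choose_spec (htight (nOf s))
  let st : ℕ → ℕ × Finset X := fun k => Nat.rec (0, ∅) (fun _ s => (nOf s, s.2 ∪ EOf s)) k
  have st_succ : ∀ k, st (k + 1) = (nOf (st k), (st k).2 ∪ EOf (st k)) := fun k => rfl
  let nk : ℕ → ℕ := fun k => nOf (st k)
  let Φk : ℕ → Finset X := fun k => (st k).2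
  let Ek : ℕ → Finset X := fun k => EOf (st k)
  let Fk : ℕ → Finset X := fun k => ((Ek k).filter (fun x => x ∈ U (nk k))) \ Φk k
  have Φ_succ : ∀ k, Φk (k + 1) = Φk k ∪ Ek k := fun k => rfl
  have nk_strictMono : StrictMono nk := by
    refine strictMono_nat_of_lt_succ fun k => ?_
    have h' := (nOf_spec (st (k + 1))).1
    exact h'
  have Φ_mono : Monotone Φk :=
    monotone_nat_of_le_succ fun k => by rw [Φ_succ]; exact Finset.subset_union_left
  have E_sub_Φ : ∀ {j k : ℕ}, j < k → Ek j ⊆ Φk k := by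
    intro j k hjk
    have h1 : Ek j ⊆ Φk (j + 1) := by rw [Φ_succ]; exact Finset.subset_union_right
    exact h1.trans (Φ_mono (Nat.succ_le_of_lt hjk))
  have F_sub_E : ∀ k, Fk k ⊆ Ek k := fun k => Finset.sdiff_subset.trans (Finset.filter_subset _ _)
  have F_sub_U : ∀ k, (↑(Fk k) : Set X) ⊆ U (nk k) := by
    intro k x hx
    have hx' := Finset.mem_sdiff.1 (Finset.mem_coe.1 hx)
    exact (Finset.mem_filter.1 hx'.1).2
  have F_disj_Φ : ∀ k, Disjoint (Fk k) (Φk k) := fun k => Finset.sdiff_disjoint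
  -- the single test set
  let S : Set X := ⋃ k, (↑(Fk k) : Set X)
  have S_sub : ∀ k, S ⊆ (↑(Fk k) ∪ ↑(Φk k)) ∪ (↑(Ek k))ᶜ := by
    intro k x hx
    obtain ⟨j, hj⟩ := Set.mem_iUnion.1 hx
    rcases lt_trichotomy j k with hjk | rfl | hkj
    · exact Or.inl (Or.inr (Finset.mem_coe.2 (E_sub_Φ hjk (F_sub_E j (Finset.mem_coe.1 hj)))))
    · exact Or.inl (Or.inl hj)
    · refine Or.inr fun hxE => ?_
      have hxΦ : x ∈ Φk j := E_sub_Φ hkj (Finset.mem_coe.1 hxE)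
      exact Finset.disjoint_left.1 (F_disj_Φ j) (Finset.mem_coe.1 hj) hxΦ
  have F_sub_S : ∀ k, (↑(Fk k) : Set X) ⊆ S := fun k =>
    Set.subset_iUnion (fun k => (↑(Fk k) : Set X)) k
  have U_sub : ∀ k, U (nk k) ⊆ (↑(Fk k) ∪ (↑(Ek k))ᶜ) ∪ ↑(Φk k) := by
    intro k x hxU
    by_cases hxE : x ∈ Ek k
    · by_cases hxΦ : x ∈ Φk k
      · exact Or.inr (Finset.mem_coe.2 hxΦ)
      · exact Or.inl (Or.inl (Finset.mem_coe.2
          (Finset.mem_sdiff.2 ⟨Finset.mem_filter.2 ⟨hxE, hxU⟩, hxΦ⟩)))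
    · exact Or.inl (Or.inr fun h' => hxE (Finset.mem_coe.1 h'))
  -- the discrepancy on S is bounded below at every stage
  have hgap : ∀ k, 3 / 8 ≤ |(PMF.toOuterMeasure (P (nk k)) S).toReal - (PMF.toOuterMeasure (Q (nk k)) S).toReal| := by
    intro k
    have hspec := nOf_spec (st k)
    have hE := EOf_spec (st k)
    have hdΦ : d (nk k) (Φk k) ≤ 1 / 16 := hspec.2.1
    have hPU : 15 / 16 ≤ (PMF.toOuterMeasure (P (nk k)) ((U (nk k)))).toReal := hspec.2.2.1
    have hQV : 15 / 16 ≤ (PMF.toOuterMeasure (Q (nk k)) ((V (nk k)))).toReal := hspec.2.2.2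
    have hPE : (PMF.toOuterMeasure (P (nk k)) ((↑(Ek k))ᶜ)).toReal ≤ 1 / 16 := hE.1
    have hQE : (PMF.toOuterMeasure (Q (nk k)) ((↑(Ek k))ᶜ)).toReal ≤ 1 / 16 := hE.2
    have hPΦ : (PMF.toOuterMeasure (P (nk k)) (↑(Φk k))).toReal ≤ 3 / 16 := by
      have h' := mass_finset_le_of_disjoint (P (nk k)) (Q (nk k)) (hUV (nk k)) (Φk k)
      have hd' : ∑ x ∈ Φk k, |(PMF.toOuterMeasure (P (nk k)) {x}).toReal - (PMF.toOuterMeasure (Q (nk k)) {x}).toReal| = d (nk k) (Φk k) :=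
        rfl
      linarith
    have hQΦ : (PMF.toOuterMeasure (Q (nk k)) (↑(Φk k))).toReal ≤ 3 / 16 := by
      have h' := mass_finset_le_of_disjoint (Q (nk k)) (P (nk k)) (hUV (nk k)).symm (Φk k)
      have hd' : ∑ x ∈ Φk k, |(PMF.toOuterMeasure (Q (nk k)) {x}).toReal - (PMF.toOuterMeasure (P (nk k)) {x}).toReal| = d (nk k) (Φk k) := by
        simp only [hd]
        exact Finset.sum_congr rfl fun x _ => abs_sub_comm _ _
      linarith
    have hPS : 11 / 16 ≤ (PMF.toOuterMeasure (P (nk k)) S).toReal := by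
      have h1 : (PMF.toOuterMeasure (P (nk k)) ((U (nk k)))).toReal ≤ (PMF.toOuterMeasure (P (nk k)) (↑(Fk k))).toReal +
          (PMF.toOuterMeasure (P (nk k)) ((↑(Ek k))ᶜ)).toReal + (PMF.toOuterMeasure (P (nk k)) (↑(Φk k))).toReal := by
        calc (PMF.toOuterMeasure (P (nk k)) ((U (nk k)))).toReal
            ≤ (PMF.toOuterMeasure (P (nk k)) (((↑(Fk k) ∪ (↑(Ek k))ᶜ) ∪ ↑(Φk k)))).toReal := mass_mono _ (U_sub k)
          _ ≤ (PMF.toOuterMeasure (P (nk k)) ((↑(Fk k) ∪ (↑(Ek k))ᶜ))).toReal + (PMF.toOuterMeasure (P (nk k)) (↑(Φk k))).toReal :=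
              mass_union_le _ _ _
          _ ≤ _ := by
              have h'' := mass_union_le (P (nk k)) ↑(Fk k) (↑(Ek k))ᶜ
              linarith
      have h2 : (PMF.toOuterMeasure (P (nk k)) (↑(Fk k))).toReal ≤ (PMF.toOuterMeasure (P (nk k)) S).toReal := mass_mono _ (F_sub_S k)
      linarith
    have hQS : (PMF.toOuterMeasure (Q (nk k)) S).toReal ≤ 5 / 16 := by
      have h1 : (PMF.toOuterMeasure (Q (nk k)) S).toReal ≤ (PMF.toOuterMeasure (Q (nk k)) (↑(Fk k))).toReal + (PMF.toOuterMeasure (Q (nk k)) (↑(Φk k))).toReal +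
          (PMF.toOuterMeasure (Q (nk k)) ((↑(Ek k))ᶜ)).toReal := by
        calc (PMF.toOuterMeasure (Q (nk k)) S).toReal
            ≤ (PMF.toOuterMeasure (Q (nk k)) (((↑(Fk k) ∪ ↑(Φk k)) ∪ (↑(Ek k))ᶜ))).toReal := mass_mono _ (S_sub k)
          _ ≤ (PMF.toOuterMeasure (Q (nk k)) ((↑(Fk k) ∪ ↑(Φk k)))).toReal + (PMF.toOuterMeasure (Q (nk k)) ((↑(Ek k))ᶜ)).toReal :=
              mass_union_le _ _ _
          _ ≤ _ := by
              have h'' := mass_union_le (Q (nk k)) ↑(Fk k) ↑(Φk k)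
              linarith
      have h2 : (PMF.toOuterMeasure (Q (nk k)) (↑(Fk k))).toReal ≤ 1 - (PMF.toOuterMeasure (Q (nk k)) ((V (nk k)))).toReal := by
        have hsub : (↑(Fk k) : Set X) ⊆ (V (nk k))ᶜ := fun x hx hxV =>
          Set.disjoint_left.1 (hUV (nk k)) (F_sub_U k hx) hxV
        have h' := mass_mono (Q (nk k)) hsub
        have hc := mass_add_compl (Q (nk k)) (V (nk k))
        linarith
      linarith
    rw [le_abs]
    exact Or.inl (by linarith)
  -- contradiction with the hypothesis on the test S along the subsequence nk
  have hlim : Tendsto (fun k => |(PMF.toOuterMeasure (P (nk k)) S).toReal - (PMF.toOuterMeasure (Q (nk k)) S).toReal|) atTop (𝓝 0) :=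
    (h S).comp nk_strictMono.tendsto_atTop
  obtain ⟨k, hk⟩ := (hlim.eventually_lt_const (show (0 : ℝ) < 3 / 8 by norm_num)).exists
  exact absurd (hgap k) (not_le.2 hk)

/-- Corollary used for the "statistically close" strengthening: under clause (ii) the
statistical distance is eventually large — already the single moving event `U n` has
`P n (U n) − Q n (U n) ≥ P n (U n) + Q n (V n) − 1 → 1`. So the natural strengthening of the crux
to statistically indistinguishable twins is false for every pair of ensembles. [folklore] -/
theorem tv_lower_bound (p q : PMF X) {U V : Set X} (hUV : Disjoint U V) :
    (PMF.toOuterMeasure p U).toReal + (PMF.toOuterMeasure q V).toReal - 1 ≤ (PMF.toOuterMeasure p U).toReal - (PMF.toOuterMeasure q U).toReal := by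
  have hsub : U ⊆ Vᶜ := fun x hxU hxV => Set.disjoint_left.1 hUV hxU hxV
  have h' := mass_mono q hsub
  have hc := mass_add_compl q V
  linarith

/-- The strengthening "some event sequence separates while the SAME event sequence is
indistinguishable" is contradictory: with `P n (U n) → 1`, `Q n (V n) → 1`, `U n ∩ V n = ∅`,
the gap on `U n` tends to `1`, not `0`. [folklore] -/
theorem not_indistinguishable_on_separating_events (P Q : ℕ → PMF X) (U V : ℕ → Set X)
    (hUV : ∀ n, Disjoint (U n) (V n))
    (hP : Tendsto (fun n => (PMF.toOuterMeasure (P n) (U n)).toReal) atTop (𝓝 1))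
    (hQ : Tendsto (fun n => (PMF.toOuterMeasure (Q n) (V n)).toReal) atTop (𝓝 1))
    (h : Tendsto (fun n => (PMF.toOuterMeasure (P n) (U n)).toReal - (PMF.toOuterMeasure (Q n) (U n)).toReal) atTop (𝓝 0)) : False := by
  have e1 := h.eventually_lt_const (show (0 : ℝ) < 1 / 2 by norm_num)
  have e2 := hP.eventually_const_lt (show (3 / 4 : ℝ) < 1 by norm_num)
  have e3 := hQ.eventually_const_lt (show (3 / 4 : ℝ) < 1 by norm_num)
  obtain ⟨n, hn1, hn2, hn3⟩ := (e1.and (e2.and e3)).exists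
  have h' := tv_lower_bound (P n) (Q n) (hUV n)
  linarith

/-! ## From `RandAlg` tests to sets: deterministic indicator tests -/

/-- The acceptance functional of the deterministic indicator test of `S` against a `PMF` is the
mass of `S`: `Σ' x, D(x) · Pr[1_S(x) = true] = D(S)`. [folklore] -/
theorem tsum_indicatorTest_eq_mass (D : PMF (List Bool)) (S : Set (List Bool))
    [DecidablePred (· ∈ S)] :
    ∑' x, (D x).toReal * (RandAlg.ofDet fun x => decide (x ∈ S)).pr id x {b | b = true}
      = (PMF.toOuterMeasure D S).toReal := by
  classical
  have hpr : ∀ x, (RandAlg.ofDet fun x => decide (x ∈ S)).pr id x {b | b = true}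
      = if x ∈ S then 1 else 0 := by
    intro x
    rw [RandAlg.pr_ofDet]
    by_cases hx : x ∈ S <;> simp [hx]
  simp_rw [hpr]
  rw [PMF.toOuterMeasure_apply, ENNReal.tsum_toReal_eq (fun x => ?_)]
  · refine tsum_congr fun x => ?_
    by_cases hx : x ∈ S
    · simp [hx]
    · simp [hx]
  · exact ((Set.indicator_le_self S D x).trans_lt (PMF.apply_lt_top D x)).ne

/-- The crux with the time bound on the tests DROPPED, for an arbitrary count function `N`
(abstract form of `PseudorandomTwinsAboveWithoutPolyTime`): contradictory. [folklore] -/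
theorem no_twins_against_unbounded_tests (N : List Bool → ℕ) (D₀ D₁ : Ensemble) (t : ℕ → ℕ)
    (hind : ∀ A : RandAlg (List Bool) Bool, Tendsto (fun n : ℕ =>
      |(∑' x : List Bool, ((D₀ n) x).toReal * A.pr id x {b | b = true}) -
        (∑' x : List Bool, ((D₁ n) x).toReal * A.pr id x {b | b = true})|) atTop (𝓝 0))
    (h₀ : Tendsto (fun n : ℕ => D₀.prob n {x | 8 * t n ≤ N x}) atTop (𝓝 1))
    (h₁ : Tendsto (fun n : ℕ => D₁.prob n {x | 0 < N x ∧ N x ≤ t n}) atTop (𝓝 1)) : False := by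
  classical
  refine no_setwise_indistinguishable_far_pair D₀ D₁ (fun n => {x | 8 * t n ≤ N x})
    (fun n => {x | 0 < N x ∧ N x ≤ t n}) ?_ h₀ h₁ ?_
  · intro n
    rw [Set.disjoint_left]
    rintro x (hx : 8 * t n ≤ N x) ⟨hpos, hle⟩
    omega
  · intro S
    have h' := hind (RandAlg.ofDet fun x => decide (x ∈ S))
    simp only [tsum_indicatorTest_eq_mass] at h'
    exact h'

/-! ## (a) Load-bearing hypothesis: the crux without the time bound on the tests is FALSE -/

open scoped Classical in
/-- ANY PROOF OF THE CRUX MUST USE THE TIME BOUND ON THE TESTS. The negated statement below is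
`PseudorandomTwinsAbove` VERBATIM with the hypothesis `A.IsPolyTime id encodeBool` of clause (i)
dropped (tests = every `RandAlg (List Bool) Bool`, still index-free: they never see `n`); it is
false. Witness: the single set `S` of `no_setwise_indistinguishable_far_pair`, run as the
deterministic test `1_S` (`RandAlg.ofDet`, no coins). (Named `PseudorandomTwinsAboveWithoutPolyTime`
in the disprover's work file.) [this work] -/
theorem pseudorandomTwinsAbove_false_without_polyTime : ¬ (∃ Δ p q : ℕ, 3 ≤ Δ ∧ 0 < q ∧ ((Δ : ℝ) - 1) ^ (Δ - 1) / ((Δ : ℝ) - 2) ^ Δ < (p : ℝ) / q ∧ ∃ D₀ D₁ : Literature.Computability.MetaComplexity.Ensemble, D₀.IsPolySamplable ∧ D₁.IsPolySamplable ∧ (∀ A : Literature.Computability.Complexity.RandAlg (List Bool) Bool, Filter.Tendsto (fun n : ℕ => |(∑' x : List Bool, ((D₀ n) x).toReal * A.pr id x {b | b = true}) - (∑' x : List Bool, ((D₁ n) x).toReal * A.pr id x {b | b = true})|) Filter.atTop (nhds 0)) ∧ ∃ t : ℕ → ℕ, Filter.Tendsto (fun n : ℕ => D₀.prob n {x | 8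 * t n ≤ (match Literature.Computability.Complexity.encodingGraph.decode x with | none => 0 | some G => if G.2.maxDegree ≤ Δ then ∑ I : Finset (Fin G.1), (if G.2.IsIndepSet (↑I : Set (Fin G.1)) then p ^ I.card * q ^ (G.1 - I.card) else 0) else 0)}) Filter.atTop (nhds 1) ∧ Filter.Tendsto (fun n : ℕ => D₁.prob n {x | 0 < (match Literature.Computability.Complexity.encodingGraph.decode x with | none => 0 | some G => if G.2.maxDegree ≤ Δ then ∑ I : Finset (Fin G.1), (if G.2.IsIndepSet (↑I : Set (Fin G.1)) then p ^ I.card * q ^ (G.1 - I.card) else 0) else 0) ∧ (match Literature.Computability.Complexity.encodingGraph.decode x with | none => 0 | some G => if G.2.maxDegree ≤ Δ then ∑ I : Finset (Fin G.1), (if G.2.IsIndepSet (↑I : Set (Fin G.1)) then p ^ I.card * q ^ (G.1 - I.card) else 0) else 0) ≤ t n}) Filter.atTop (nhds 1)) := by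
  rintro ⟨Δ, p, q, -, -, -, D₀, D₁, -, -, hind, t, h₀, h₁⟩
  exact no_twins_against_unbounded_tests _ D₀ D₁ t hind h₀ h₁

end

end Summit.PneNP.PneNP.Theorems.PseudorandomTwinsAbove.Negative
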